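import Mathlib
import Summits.NavierStokesRegularity.NavierStokesRegularity.Theorems.SubOnsagerCeilingDyadicDampedChainForced
import Summits.NavierStokesRegularity.NavierStokesRegularity.Theorems.SubOnsagerCeilingKPSideBranchClassDynamics
import Summits.NavierStokesRegularity.NavierStokesRegularity.Theorems.SubOnsagerCeilingKPPairSlaving
import Summits.NavierStokesRegularity.NavierStokesRegularity.Theorems.OrthantWakeOrthantBreakOfWake
import HarnessLib

/-!
# ν-uniform envelopes for the side-branch class of KP networks proper, `b ∈ [1.9, 2]` — the two STEPS of
# the joint bootstrap «chain barrier under slaved damping + pair slaving of the side source»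
(helper file for crux stmt-NavierStokesRegularity-27057 `SubOnsagerCeiling.ForwardTailCeilingKP`,
`--supports … --as helper`; LEAD SOC census v6 §C)

THE CLASS (def-free, see `SubOnsagerCeilingKPSideBranchClassDynamics`): a KP network proper with the chain
`0 → 0` (weight `c₀ > 0`), the in-shell pump `0 → 1` (weight `P ≥ 0`), the exit feed `1 → 2` (weight
`f > 0`) into a DEAD-END pocket, nothing else — the architecture of the 25507 witness `sideBranchTable`.
SMALLNESS (the joint region closes): for some `κ > 0`,
`13 P² < f² κ⁴` (pair slaving / viscous slaving of the side source at the level `κ ×` chain envelope) and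
`5 P κ b^{5/2} ≤ c₀ b^{2θ}`, `P b^{5/2} ≤ 2 c₀ b^{2θ}` (the side drain on the chain is at most one fifth of
the chain's own rate scale; `θ = 101/200`). E.g. `c₀ = f = 1`, `κ = 1`, `P ≤ 7/100` at every `b ∈ [1.9,2]`.

THIS FILE proves the energy bound `sideClass_mode_le_energy` and the two steps `sideClass_chainEnv`,
`sideClass_sideStrict`; the bootstrap itself (`sideClass_envelopes`) is the sibling file
`SubOnsagerCeilingKPSideBranchClassEnvelopes`. TARGET (there): along EVERY honest non-negative `ν`-viscous solution from a one-shell datum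
`X₀` (all four components, signed) on a window `[0, s]`, for every `ν > 0`, with `E₀ = Σ_j ½X₀_j²` and
`b = 1 + ε₀ ∈ [1.9, 2]`:

  `b^{2θk} X_{0,k}(t)² ≤ 200 E₀`  (all `k ≥ 0`),   `b^{2θk} X_{1,k}(t)² ≤ 200 κ² E₀`  (all `k ≥ 1`).

PROOF = the bootstrap announced in census v6: (i) energy (`orthantBreak_energy_le`) bounds every mode by
`Ē = √(2E₀)`, in particular the signed shell `0` (`sideClass_mode_le_energy`); (ii) maximal time of the
side envelope on the finitely many shells not already controlled by Tao's weight bound; (iii) on `[0,T*]`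
the side envelope makes the chain's extra damping `PΛ_k X_{1,k} ≤ F_{k+1}/5`, so
`chain_shellBarrier_damped'` (p651721) gives the chain envelope `F_k = 10Ē b^{-θk}` (`sideClass_chainEnv`);
(iv) per shell, either the viscous rate `νb^{2(k+1)}` is below `(2Pb²/κ)Λ_kF_k` and the pair lemma
`kpProper_pairSlaving` (p646904; `I₀ = PΛ_kF_k²`, dead-end target `ρ₀ = 0`) gives `X_{1,k} < κF_k`
STRICTLY, or it is above and `linearSlaving_le` gives `X_{1,k} ≤ κF_k/2` (`sideClass_sideStrict`);
(v) strictness + continuity extend the side envelope past `T*`. So `T* = s`.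

HONEST FRAMING: a theorem about Tao-type MODEL lattice tables (rung under crux `ForwardTailCeilingKP`, route
SubOnsagerCeiling, TL-M2Break): the first KP-proper class WITH A DEAD-END POCKET whose forward sources
(components `0, 1`) are ν-uniformly enveloped at `θ > 1/2` in the kernel — the total tail (with the pocket)
is NOT claimed (25507's refutation); nothing here bears on Navier–Stokes regularity; 27057 stays OPEN.
-/

noncomputable section

-- the sub-problem namespace `NavierStokesRegularity.NavierStokesRegularity` is the tree's layout (D-0017)
set_option linter.dupNamespace false

namespace Summit.NavierStokesRegularity.NavierStokesRegularity.Theorems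

open Set Filter Topology
open Literature.Analysis.FluidPDE.TaoCascade
open Summit.NavierStokesRegularity.NavierStokesRegularity.Theorems.DyadicRange
open Summit.NavierStokesRegularity.NavierStokesRegularity.Theorems.DyadicDamped

/-- Single modes are bounded by the datum energy: `½X_{i,k}(t)² ≤ E₀` for `k ≥ 0` along an honest viscous
solution of a cancelling table (from `orthantBreak_energy_le`). [this file] -/
theorem sideClass_mode_le_energy {ε₀ ν s M : ℝ} (hε : 0 < ε₀) (hν : 0 < ν)
    {α : Fin 4 → Fin 4 → Fin 4 → ℤ × ℤ × ℤ → ℝ} (hc : IsCancellingCoeff α)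
    {X₀ : Fin 4 → ℝ} {X : Fin 4 → ℤ → ℝ → ℝ}
    (hinit : ∀ (i : Fin 4) (k : ℤ), X i k 0 = if k = 0 then X₀ i else 0)
    (hlow : ∀ (i : Fin 4) (k : ℤ), k < 0 → ∀ t : ℝ, X i k t = 0)
    (hM : ∀ (t : ℝ) (i : Fin 4) (k : ℤ), (1 + (1 + ε₀) ^ ((10 : ℝ) * k)) * |X i k t| ≤ M)
    (hder : ∀ (i : Fin 4) (k : ℤ), ∀ t ∈ Icc (0 : ℝ) s, HasDerivWithinAt (X i k)
      (quadTerm ε₀ α X i k t - ν * (1 + ε₀) ^ ((2 : ℝ) * k) * X i k t) (Icc (0 : ℝ) s) t)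
    {t : ℝ} (ht : t ∈ Icc (0 : ℝ) s) (i : Fin 4) (k : ℕ) :
    (1 / 2 : ℝ) * X i (k : ℤ) t ^ 2 ≤ ∑ j : Fin 4, (1 / 2 : ℝ) * X₀ j ^ 2 := by
  have hE := orthantBreak_energy_le hε hν hc hinit hlow hM hder ht
  have hsum := orthantBreak_summable hε hM 0 t
  simp only [Nat.cast_zero, zero_add] at hsum
  have h1 : (1 / 2 : ℝ) * X i (k : ℤ) t ^ 2 ≤ ∑ i' : Fin 4, (1 / 2 : ℝ) * X i' (k : ℤ) t ^ 2 :=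
    Finset.single_le_sum (f := fun i' => (1 / 2 : ℝ) * X i' (k : ℤ) t ^ 2)
      (fun i' _ => by positivity) (Finset.mem_univ i)
  have h2 : ∑ i' : Fin 4, (1 / 2 : ℝ) * X i' (k : ℤ) t ^ 2 ≤
      ∑' j : ℕ, ∑ i' : Fin 4, (1 / 2 : ℝ) * X i' (j : ℤ) t ^ 2 :=
    hsum.le_tsum k (fun j _ => Finset.sum_nonneg fun i' _ => by positivity)
  linarith

section SideClass

variable {ε₀ ν s c₀ P f κ Eb : ℝ} {α : Fin 4 → Fin 4 → Fin 4 → ℤ × ℤ × ℤ → ℝ}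
  {X₀ : Fin 4 → ℝ} {X : Fin 4 → ℤ → ℝ → ℝ}

/-- **Step (iii): the chain envelope on a window where the side envelope holds.** With `B₁ = b^θ`,
`Ē ≥ |X_{0,0}|, |X_{1,0}|` on `[0,s]` (energy), and `B₁^k X_{1,k} ≤ 10κĒ` for `k ≥ 1` on `[0,T']`
(`0 < T' ≤ s`), the damped chain barrier gives `B₁^{2k} X_{0,k}² ≤ 100Ē²` on `[0,T']`. [this file] -/
theorem sideClass_chainEnv (hε : 9 / 10 ≤ ε₀) (hε1 : ε₀ ≤ 1) (hν : 0 < ν)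
    (hsy : IsSymmetricCoeff α) (hc : IsCancellingCoeff α)
    (hO : ∀ (Y : Fin 4 → ℤ → ℝ → ℝ) (τ : ℝ), (∀ (j : Fin 4) (k : ℤ), 1 ≤ k → 0 ≤ Y j k τ) →
      ∀ δ : ℝ, 0 < δ → ∀ (i : Fin 4) (n : ℤ), 1 ≤ n → Y i n τ = 0 → 0 ≤ quadTerm δ α Y i n τ)
    (hD : ∀ a b i : Fin 4, a ≠ b → α a b i (0, 0, 1) = 0)
    (hw : ∀ a c : Fin 4, α a a c (0, 0, 1) = (if a = 0 ∧ c = 0 then c₀ else 0) + (if a = 1 ∧ c = 2 then f else 0))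
    (hP : ∀ a c : Fin 4, a ≠ c → α a a c (0, 0, 0) = if a = 0 ∧ c = 1 then P else 0)
    (hCz : ∀ a b c : Fin 4, a ≠ b → a ≠ c → b ≠ c → α a b c (0, 0, 0) = 0)
    (hc₀ : 0 < c₀) (hP0 : 0 ≤ P)
    (hdrain : 5 * P * κ * (1 + ε₀) ^ ((5 : ℝ) / 2) ≤ c₀ * ((1 + ε₀) ^ ((101 : ℝ) / 200)) ^ 2)
    (hP1 : P * (1 + ε₀) ^ ((5 : ℝ) / 2) ≤ 2 * c₀ * ((1 + ε₀) ^ ((101 : ℝ) / 200)) ^ 2)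
    (hX0 : ∀ (i : Fin 4) (k : ℤ), X i k 0 = if k = 0 then X₀ i else 0)
    (hvan : ∀ (i : Fin 4) (k : ℤ), k < 0 → ∀ t : ℝ, X i k t = 0)
    {M : ℝ} (hM : ∀ (t : ℝ) (i : Fin 4) (k : ℤ), (1 + (1 + ε₀) ^ ((10 : ℝ) * k)) * |X i k t| ≤ M)
    (hXc : ∀ (i : Fin 4) (k : ℤ), Continuous (X i k))
    (hode : ∀ (i : Fin 4) (k : ℤ), ∀ t ∈ Icc (0 : ℝ) s, HasDerivWithinAt (X i k)
      (quadTerm ε₀ α X i k t - ν * (1 + ε₀) ^ ((2 : ℝ) * k) * X i k t) (Icc (0 : ℝ) s) t)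
    (hnn : ∀ t ∈ Icc (0 : ℝ) s, ∀ (i : Fin 4) (k : ℤ), 1 ≤ k → 0 ≤ X i k t)
    (hEb0 : 0 ≤ Eb) (hE00 : ∀ t ∈ Icc (0 : ℝ) s, |X 0 0 t| ≤ Eb) (hE10 : ∀ t ∈ Icc (0 : ℝ) s, |X 1 0 t| ≤ Eb)
    {T' : ℝ} (hT' : 0 < T') (hT's : T' ≤ s)
    (hside : ∀ k : ℕ, 1 ≤ k → ∀ t ∈ Icc (0 : ℝ) T',
      ((1 + ε₀) ^ ((101 : ℝ) / 200)) ^ k * X 1 (k : ℤ) t ≤ 10 * κ * Eb) :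
    ∀ t ∈ Icc (0 : ℝ) T', ∀ k : ℕ,
      ((1 + ε₀) ^ ((101 : ℝ) / 200)) ^ (2 * k) * X 0 (k : ℤ) t ^ 2 ≤ 100 * Eb ^ 2 := by
  have hb19 : 19 / 10 ≤ 1 + ε₀ := by linarith
  have hb2 : 1 + ε₀ ≤ 2 := by linarith
  have hb0 : (0 : ℝ) < 1 + ε₀ := by linarith
  set B₁ : ℝ := (1 + ε₀) ^ ((101 : ℝ) / 200) with hB₁
  set B₅ : ℝ := (1 + ε₀) ^ ((5 : ℝ) / 2) with hB₅
  have hB₁0 : 0 < B₁ := Real.rpow_pos_of_pos hb0 _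
  have hB₅0 : 0 < B₅ := Real.rpow_pos_of_pos hb0 _
  have hΛ : ∀ k : ℕ, (1 + ε₀) ^ ((5 : ℝ) * (k : ℝ) / 2) = B₅ ^ k := by
    intro k
    rw [hB₅, ← Real.rpow_mul_natCast hb0.le]; congr 1; ring
  have hsub : Icc (0 : ℝ) T' ⊆ Icc (0 : ℝ) s := Icc_subset_Icc_right hT's
  refine chain_shellBarrier_damped' (Z := fun k => X 0 k)
    (E := fun k t => P * (1 + ε₀) ^ ((5 : ℝ) * (k : ℝ) / 2) * X 1 (k : ℤ) t) (x₀ := X₀ 0) (Eb := Eb)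
    hb19 hb2 hc₀ hν hT' ?_ ?_ ?_ ?_ ?_ ?_ ?_ ?_ ?_ ?_
  · intro k; exact hX0 0 k
  · intro t; exact hvan 0 (-1) (by norm_num) t
  · exact ⟨M, fun t k => by simpa using hM t 0 (k : ℤ)⟩
  · intro k; exact (hXc 0 k).continuousOn
  · intro k; exact (continuous_const.mul (hXc 1 k)).continuousOn
  · intro t ht; exact hE00 t (hsub ht)
  · intro k hk t ht
    have h1 : 0 ≤ X 1 (k : ℤ) t := hnn t (hsub ht) 1 k (by exact_mod_cast hk)
    have h2 : 0 ≤ (1 + ε₀) ^ ((5 : ℝ) * (k : ℝ) / 2) := (Real.rpow_pos_of_pos hb0 _).le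
    positivity
  · intro k t ht
    show P * (1 + ε₀) ^ ((5 : ℝ) * (k : ℝ) / 2) * X 1 (k : ℤ) t ≤ 2 * c₀ * Eb * (B₁ ^ 2 / B₅) * (B₅ / B₁) ^ k
    rw [hΛ k]
    rcases Nat.eq_zero_or_pos k with hk0 | hkpos
    · -- the datum shell: energy bound and `P b^{5/2} ≤ 2c₀ b^{2θ}`
      subst hk0
      have h1 : X 1 0 t ≤ Eb := (le_abs_self _).trans (hE10 t (hsub ht))
      have h2 : P * X 1 0 t ≤ P * Eb := mul_le_mul_of_nonneg_left h1 hP0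
      have h3 : P * Eb * B₅ ≤ 2 * c₀ * Eb * B₁ ^ 2 := by
        have := mul_le_mul_of_nonneg_right hP1 hEb0
        linarith
      have h4 : P * Eb ≤ 2 * c₀ * Eb * (B₁ ^ 2 / B₅) := by
        rw [show 2 * c₀ * Eb * (B₁ ^ 2 / B₅) = (2 * c₀ * Eb * B₁ ^ 2) / B₅ by ring, le_div_iff₀ hB₅0]
        exact h3
      simp only [Nat.cast_zero, pow_zero, mul_one]
      linarith
    · -- shells `k ≥ 1`: the side envelope and `5Pκ b^{5/2} ≤ c₀ b^{2θ}`
      have hsk := hside k hkpos t ht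
      have hBk : 0 < B₁ ^ k := pow_pos hB₁0 k
      -- `P B₅^k X B₁^k ≤ 10PκĒ B₅^k ≤ 2c₀Ē B₁² B₅^{k-1} B₁^... `: compare after multiplying by `B₁^k`
      have h1 : P * B₅ ^ k * X 1 (k : ℤ) t * B₁ ^ k ≤ P * B₅ ^ k * (10 * κ * Eb) := by
        have := mul_le_mul_of_nonneg_left hsk (by positivity : (0 : ℝ) ≤ P * B₅ ^ k)
        linarith
      have h3 : 10 * P * κ * B₅ ≤ 2 * c₀ * B₁ ^ 2 := by linarith
      have h2 : P * B₅ ^ k * (10 * κ * Eb) ≤ (2 * c₀ * Eb * (B₁ ^ 2 / B₅) * (B₅ / B₁) ^ k) * B₁ ^ k := by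
        rw [div_pow, show 2 * c₀ * Eb * (B₁ ^ 2 / B₅) * (B₅ ^ k / B₁ ^ k) * B₁ ^ k =
          (2 * c₀ * B₁ ^ 2) * Eb * B₅ ^ k / B₅ by field_simp]
        rw [le_div_iff₀ hB₅0]
        have := mul_le_mul_of_nonneg_right (mul_le_mul_of_nonneg_right h3 hEb0) (pow_nonneg hB₅0.le k)
        linarith
      exact le_of_mul_le_mul_right (h1.trans h2) hBk
  · intro k t ht
    have h := (hode 0 (k : ℤ) t (hsub ht)).mono hsub
    refine h.congr_deriv ?_
    rw [sideClass_quadTerm_chain hsy hc hO hD hw hP hCz ε₀ X (k : ℤ) t]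
    push_cast
    ring
  · intro t ht k hk; exact hnn t (hsub ht) 0 k (by exact_mod_cast hk)

set_option maxHeartbeats 400000 in
/-- **Step (iv): the side envelope is STRICT on a window where it and the chain envelope hold.**
For a shell `k ≥ 1`: if `X_{0,k}² ≤ F²` (`F = 10Ē/B₁^k`) on `[0,T']` then `B₁^k X_{1,k} < 10κĒ` on `[0,T']`
— by the pair slaving lemma in the inertial regime `νb^{2(k+1)} ≤ (2Pb²/κ)Λ_kF` (dead-end target) and by
linear slaving otherwise. [this file] -/
theorem sideClass_sideStrict (hε : 9 / 10 ≤ ε₀) (hε1 : ε₀ ≤ 1) (hν : 0 < ν)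
    (hsy : IsSymmetricCoeff α) (hc : IsCancellingCoeff α)
    (hO : ∀ (Y : Fin 4 → ℤ → ℝ → ℝ) (τ : ℝ), (∀ (j : Fin 4) (k : ℤ), 1 ≤ k → 0 ≤ Y j k τ) →
      ∀ δ : ℝ, 0 < δ → ∀ (i : Fin 4) (n : ℤ), 1 ≤ n → Y i n τ = 0 → 0 ≤ quadTerm δ α Y i n τ)
    (hD : ∀ a b i : Fin 4, a ≠ b → α a b i (0, 0, 1) = 0)
    (hw : ∀ a c : Fin 4, α a a c (0, 0, 1) = (if a = 0 ∧ c = 0 then c₀ else 0) + (if a = 1 ∧ c = 2 then f else 0))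
    (hP : ∀ a c : Fin 4, a ≠ c → α a a c (0, 0, 0) = if a = 0 ∧ c = 1 then P else 0)
    (hCz : ∀ a b c : Fin 4, a ≠ b → a ≠ c → b ≠ c → α a b c (0, 0, 0) = 0)
    (hP0 : 0 ≤ P) (hf : 0 < f) (hκ : 0 < κ) (hpair : 13 * P ^ 2 < f ^ 2 * κ ^ 4)
    (hX0 : ∀ (i : Fin 4) (k : ℤ), X i k 0 = if k = 0 then X₀ i else 0)
    (hode : ∀ (i : Fin 4) (k : ℤ), ∀ t ∈ Icc (0 : ℝ) s, HasDerivWithinAt (X i k)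
      (quadTerm ε₀ α X i k t - ν * (1 + ε₀) ^ ((2 : ℝ) * k) * X i k t) (Icc (0 : ℝ) s) t)
    (hnn : ∀ t ∈ Icc (0 : ℝ) s, ∀ (i : Fin 4) (k : ℤ), 1 ≤ k → 0 ≤ X i k t)
    (hEbpos : 0 < Eb) {T' : ℝ} (hT's : T' ≤ s) {k : ℕ} (hk : 1 ≤ k)
    (hchain : ∀ τ ∈ Icc (0 : ℝ) T',
      X 0 (k : ℤ) τ ^ 2 ≤ (10 * Eb / ((1 + ε₀) ^ ((101 : ℝ) / 200)) ^ k) ^ 2) :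
    ∀ t ∈ Icc (0 : ℝ) T', ((1 + ε₀) ^ ((101 : ℝ) / 200)) ^ k * X 1 (k : ℤ) t < 10 * κ * Eb := by
  intro t ht
  have hb0 : (0 : ℝ) < 1 + ε₀ := by linarith
  have hb2 : 1 + ε₀ ≤ 2 := by linarith
  have hε0 : 0 < ε₀ := by linarith
  set B₁ : ℝ := (1 + ε₀) ^ ((101 : ℝ) / 200) with hB₁
  set B₅ : ℝ := (1 + ε₀) ^ ((5 : ℝ) / 2) with hB₅
  have hB₁0 : 0 < B₁ := Real.rpow_pos_of_pos hb0 _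
  have hB₅0 : 0 < B₅ := Real.rpow_pos_of_pos hb0 _
  have hBk : 0 < B₁ ^ k := pow_pos hB₁0 k
  have hsub : Icc (0 : ℝ) T' ⊆ Icc (0 : ℝ) s := Icc_subset_Icc_right hT's
  have hΛ : (1 + ε₀) ^ ((5 : ℝ) * ((k : ℤ) : ℝ) / 2) = B₅ ^ k := by
    rw [hB₅, ← Real.rpow_mul_natCast hb0.le]; push_cast; congr 1; ring
  have hf12 : α 1 1 2 (0, 0, 1) = f := by rw [hw]; simp
  set F : ℝ := 10 * Eb / B₁ ^ k with hF
  have hF0 : 0 < F := by positivity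
  set S : ℝ := κ * F with hS
  have hS0 : 0 < S := mul_pos hκ hF0
  set Λ : ℝ := B₅ ^ k with hΛk
  have hΛ0 : 0 < Λ := pow_pos hB₅0 k
  set I₀ : ℝ := P * Λ * F ^ 2 with hI₀
  have hI0 : 0 ≤ I₀ := by positivity
  have hX1nn : ∀ τ ∈ Icc (0 : ℝ) T', 0 ≤ X 1 (k : ℤ) τ := fun τ hτ => hnn τ (hsub hτ) 1 k (by exact_mod_cast hk)
  have hX2nn : ∀ τ ∈ Icc (0 : ℝ) T', 0 ≤ X 2 ((k : ℤ) + 1) τ := fun τ hτ => hnn τ (hsub hτ) 2 _ (by omega)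
  -- closed forms on the window
  have hqt1 : ∀ τ : ℝ, quadTerm ε₀ α X 1 (k : ℤ) τ =
      P * Λ * (X 0 (k : ℤ) τ * X 0 (k : ℤ) τ) - f * Λ * (X 1 (k : ℤ) τ * X 2 ((k : ℤ) + 1) τ) := by
    intro τ
    rw [sideClass_quadTerm_side hsy hc hO hD hw hP hCz ε₀ X (k : ℤ) τ, hΛ]
  have hqt2 : ∀ τ : ℝ, quadTerm ε₀ α X 2 ((k : ℤ) + 1) τ = f * Λ * X 1 (k : ℤ) τ ^ 2 := by
    intro τ
    rw [sideClass_quadTerm_pocket hsy hc hO hD hw hP hCz ε₀ X ((k : ℤ) + 1) τ]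
    have e1 : (k : ℤ) + 1 - 1 = k := by ring
    have e2 : ((5 : ℝ) * ((((k : ℤ) + 1 : ℤ) : ℝ) - 1) / 2) = (5 : ℝ) * ((k : ℤ) : ℝ) / 2 := by push_cast; ring
    rw [e1, e2, hΛ]
  -- the input into the side source is at most `I₀`
  have hIn' : ∀ τ ∈ Icc (0 : ℝ) T', quadTerm ε₀ α X 1 (k : ℤ) τ ≤
      I₀ - f * Λ * X 1 (k : ℤ) τ * X 2 ((k : ℤ) + 1) τ := by
    intro τ hτ
    rw [hqt1 τ]
    have h1 : X 0 (k : ℤ) τ * X 0 (k : ℤ) τ ≤ F ^ 2 := by rw [← sq]; exact hchain τ hτ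
    have h2 := mul_le_mul_of_nonneg_left h1 (by positivity : (0 : ℝ) ≤ P * Λ)
    have e : P * Λ * F ^ 2 = I₀ := rfl
    linarith
  -- it suffices to bound `X_{1,k} < S`
  suffices hlt : X 1 (k : ℤ) t < S by
    have h := mul_lt_mul_of_pos_left hlt hBk
    have e : B₁ ^ k * S = 10 * κ * Eb := by simp only [hS, hF]; field_simp
    linarith
  have hνk : 0 < ν * (1 + ε₀) ^ ((2 : ℝ) * ((k : ℤ) : ℝ)) := mul_pos hν (Real.rpow_pos_of_pos hb0 _)
  have hsucc : (1 + ε₀) ^ ((2 : ℝ) * ((((k : ℤ) + 1 : ℤ)) : ℝ)) =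
      (1 + ε₀) ^ ((2 : ℝ) * ((k : ℤ) : ℝ)) * (1 + ε₀) ^ 2 := by
    rw [← Real.rpow_two, ← Real.rpow_add hb0]; push_cast; ring_nf
  by_cases hreg : ν * (1 + ε₀) ^ ((2 : ℝ) * ((((k : ℤ) + 1 : ℤ)) : ℝ)) ≤ 2 * P * (1 + ε₀) ^ 2 / κ * (Λ * F)
  · -- inertial regime: the pair slaving lemma (dead-end target, `ρ₀ = 0`)
    refine kpProper_pairSlaving (ε₀ := ε₀) (ν := ν) (T := T') (I₀ := I₀) (ρ₀ := 0) (S := S)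
      (α := α) (X := X) hε0 hν.le 1 2 (k : ℤ)
      (fun τ hτ => (hode 1 (k : ℤ) τ (hsub hτ)).mono hsub)
      (fun τ hτ => (hode 2 ((k : ℤ) + 1) τ (hsub hτ)).mono hsub)
      hX1nn hX2nn (by rw [hf12]; exact hf) hI0 le_rfl hS0 ?_ ?_ ?_ ?_ t ht
    · intro τ hτ
      rw [hf12, hΛ]
      have := hIn' τ hτ
      linarith
    · intro τ hτ
      rw [hf12, hΛ, hqt2 τ, zero_mul, sub_zero]
    · -- the size condition in the inertial regime
      rw [hf12, hΛ, zero_add]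
      have hb4 : (1 + ε₀) ^ 2 ≤ 4 := by nlinarith
      have hνle : ν * (1 + ε₀) ^ ((2 : ℝ) * ((((k : ℤ) + 1 : ℤ)) : ℝ)) * κ ≤ 2 * P * (1 + ε₀) ^ 2 * (Λ * F) := by
        have := mul_le_mul_of_nonneg_right hreg hκ.le
        have e : 2 * P * (1 + ε₀) ^ 2 / κ * (Λ * F) * κ = 2 * P * (1 + ε₀) ^ 2 * (Λ * F) := by
          field_simp
        linarith
      have h1 : 8 * I₀ * (ν * (1 + ε₀) ^ ((2 : ℝ) * ((((k : ℤ) + 1 : ℤ)) : ℝ))) * S ≤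
          64 * (P ^ 2 * Λ ^ 2 * F ^ 4) := by
        have e1 : 8 * I₀ * (ν * (1 + ε₀) ^ ((2 : ℝ) * ((((k : ℤ) + 1 : ℤ)) : ℝ))) * S =
            8 * (P * Λ * F ^ 3) * (ν * (1 + ε₀) ^ ((2 : ℝ) * ((((k : ℤ) + 1 : ℤ)) : ℝ)) * κ) := by
          simp only [hI₀, hS]; ring
        rw [e1]
        have h2 := mul_le_mul_of_nonneg_left hνle (by positivity : (0 : ℝ) ≤ 8 * (P * Λ * F ^ 3))
        have h3 : 8 * (P * Λ * F ^ 3) * (2 * P * (1 + ε₀) ^ 2 * (Λ * F)) =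
            16 * (1 + ε₀) ^ 2 * (P ^ 2 * Λ ^ 2 * F ^ 4) := by ring
        have h4 : 16 * (1 + ε₀) ^ 2 * (P ^ 2 * Λ ^ 2 * F ^ 4) ≤ 64 * (P ^ 2 * Λ ^ 2 * F ^ 4) :=
          mul_le_mul_of_nonneg_right (by linarith) (by positivity)
        linarith
      have h2 : 24 * I₀ ^ 2 = 24 * (P ^ 2 * Λ ^ 2 * F ^ 4) := by simp only [hI₀]; ring
      have h3 : 7 * (f * B₅ ^ k) ^ 2 * S ^ 4 = 7 * f ^ 2 * κ ^ 4 * (Λ ^ 2 * F ^ 4) := by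
        simp only [hS, hΛk]; ring
      rw [h2, h3]
      have hpos : 0 < Λ ^ 2 * F ^ 4 := by positivity
      have h5 : 13 * P ^ 2 * (Λ ^ 2 * F ^ 4) < f ^ 2 * κ ^ 4 * (Λ ^ 2 * F ^ 4) :=
        mul_lt_mul_of_pos_right hpair hpos
      nlinarith
    · rw [hX0]; simp only [Nat.cast_eq_zero]
      rw [if_neg (by exact_mod_cast (by omega : k ≠ 0))]
      positivity
  · -- dissipative regime: linear slaving by the viscosity of the shell
    push Not at hreg
    have hmain := linearSlaving_le (s := X 1 (k : ℤ))
      (s' := fun τ => quadTerm ε₀ α X 1 (k : ℤ) τ - ν * (1 + ε₀) ^ ((2 : ℝ) * ((k : ℤ) : ℝ)) * X 1 (k : ℤ) τ)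
      (t₀ := 0) (t₁ := T') (I₀ := I₀) hνk
      (fun τ hτ => (hode 1 (k : ℤ) τ (hsub hτ)).mono hsub) ?_ ?_
    · have h1 := hmain t ht
      -- `I₀/(ν b^{2k}) ≤ S/2 < S`
      have hνk' : 2 * P / κ * (Λ * F) < ν * (1 + ε₀) ^ ((2 : ℝ) * ((k : ℤ) : ℝ)) := by
        rw [hsucc] at hreg
        have hb20 : 0 < (1 + ε₀) ^ 2 := by positivity
        by_contra hcon
        push Not at hcon
        have := mul_le_mul_of_nonneg_right hcon hb20.le
        have e : 2 * P / κ * (Λ * F) * (1 + ε₀) ^ 2 = 2 * P * (1 + ε₀) ^ 2 / κ * (Λ * F) := by ring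
        linarith
      have h2 : I₀ / (ν * (1 + ε₀) ^ ((2 : ℝ) * ((k : ℤ) : ℝ))) ≤ S / 2 := by
        rw [div_le_iff₀ hνk]
        have := mul_le_mul_of_nonneg_left hνk'.le (by positivity : (0 : ℝ) ≤ κ * F / 2)
        have e : κ * F / 2 * (2 * P / κ * (Λ * F)) = P * Λ * F ^ 2 := by field_simp
        simp only [hI₀, hS]
        nlinarith
      linarith
    · intro τ hτ
      have h := hIn' τ hτ
      have : 0 ≤ f * Λ * X 1 (k : ℤ) τ * X 2 ((k : ℤ) + 1) τ := by
        have := hX1nn τ hτ; have := hX2nn τ hτ; positivity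
      show quadTerm ε₀ α X 1 (k : ℤ) τ - ν * (1 + ε₀) ^ ((2 : ℝ) * ((k : ℤ) : ℝ)) * X 1 (k : ℤ) τ ≤
        I₀ - ν * (1 + ε₀) ^ ((2 : ℝ) * ((k : ℤ) : ℝ)) * X 1 (k : ℤ) τ
      linarith
    · rw [hX0, if_neg (by exact_mod_cast (by omega : k ≠ 0))]
      positivity

end SideClass

end Summit.NavierStokesRegularity.NavierStokesRegularity.Theorems

end
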